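import Literature.Probability.Percolation.QuotientStrictMonotonicity
import HarnessLib

/-!
# The column-enhanced percolation model on `C_n □ ℤ²` (Martineau–Severo 2019, §4, specialised)

First file of the inline proof of the named fact
`Literature.Probability.Percolation.martineauSevero_zd3_slabTorus` (`p_c(ℤ³) < p_c(C_n □ ℤ²)`,
Martineau–Severo, *Strict monotonicity of percolation thresholds under covering maps*, Ann.
Probab. 47 (2019), Cor. 2.2 with Thm. 2.1, for the covering `ℤ³ → ℤ³/nℤe₀ = C_n □ ℤ²`).

Martineau–Severo prove Theorem 2.1 by comparing `p`-percolation on the cover `𝒢` with an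
*enhanced* percolation on the quotient `ℋ` (§4): a random set `𝒞_o(ω, α)` built from the bond
configuration `ω` and independent vertex marks `α`, "an exploratory version of Aizenman–Grimmett's
essential enhancements" (Remark 3): `C_{2n+1}` is the union of the `ω`-clusters of `C_{2n}`, and
`C_{2n+2}` adds the sphere `S_{r+1}(u)` around every `u ∈ C_{2n+1}` whose ball `B_r(u)` is fully
open and whose mark `α_u` is `1`. For the concrete covering `π : ℤ³ → ℋ_n := C_n □ ℤ²`,
`(t, y) ↦ (t mod n, y)`, the fibre of a vertex is the vertical line through it and the natural
"ball" witnessing a wrap-around of the lifted cluster is ONE VERTICAL CYCLE (column)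
`K_y = C_n × {y}`. We therefore use the following column version of the enhancement, with one
mark per column `y ∈ ℤ²` (this is the only deviation from the printed model; the proofs of §§5–6
go through verbatim and become simpler):

* `SlabTorus.InCl L ω α v` — the enhanced cluster `𝒞_o(ω, α)` of the origin `o = (0, 0)` inside
  the box of columns of sup-norm `≤ L + 1`: the least set containing `o`, closed under open edges
  of `ω` having an endpoint column of sup-norm `≤ L` (rule `edge`), and under the **column bonus**
  (rule `bonus`): if some vertex of the column `K_y` lies in the cluster, `y ∈ α`, `‖y‖∞ ≤ L` and
  all `n` vertical edges of `K_y` are open, then the four neighbouring columns `K_{y ± eᵢ}` join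
  the cluster (Martineau–Severo's `C_{2n+2}`, with `B_r(u)` replaced by the column of `u` and
  `S_{r+1}(u)` by its neighbouring columns).
* `SlabTorus.Reaches L ω α` — the finite-volume event `𝓔_L = {𝒞_o ∩ S_L ≠ ∅}` of §6: the
  enhanced cluster contains a vertex whose column has sup-norm `L + 1`.
* monotonicity in `(ω, α)` (`InCl.mono`, `Reaches.mono`), locality (`InCl.congr`: only edges with
  an endpoint column in the box of radius `L` and marks in that box matter), the a-priori bound
  `InCl.pnorm_le`, and the elementary geometry of `ℋ_n` used later (columns, the `5n` edges at a
  column, sup-norms of adjacent columns, open columns are swallowed whole: `InCl.column`).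

The two-parameter weights, Russo's formula and the Aizenman–Grimmett comparison of pivotal
probabilities (§6, (diffineq) and Lemma 6.1) are in the sequel files; nothing probabilistic
happens here.

## References

* S. Martineau, F. Severo, Ann. Probab. 47 (2019) 4116–4136, §4 (the sets `C_n`, Remark 3), §6
  [MartineauSevero2019].
* M. Aizenman, G. Grimmett, J. Stat. Phys. 63 (1991) 817–835 (essential enhancements)
  [AizenmanGrimmett1991].
-/

namespace Literature.Probability.Percolation

open LatticeModels

namespace SlabTorus

variable {n : ℕ}

/-! ### Vertices, columns, sup-norm -/

/-- The vertex type of `ℋ_n = C_n □ ℤ²`: pairs (residue, planar site). [folklore] -/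
abbrev Vert (n : ℕ) : Type := ZMod n × Site 2

/-- The origin `o = (0, 0)` of `ℋ_n` (the root of Martineau–Severo, §4).
[cite: MartineauSevero2019, §4] -/
def origin (n : ℕ) : Vert n := ((0 : ZMod n), (0 : Site 2))

/-- The planar sup-norm `‖y‖∞ = max(|y₀|, |y₁|)` of a site of `ℤ²`. [folklore] -/
def pnorm (y : Site 2) : ℕ := max (y 0).natAbs (y 1).natAbs

/-- `‖0‖∞ = 0`. [folklore] -/
@[simp] theorem pnorm_zero : pnorm (0 : Site 2) = 0 := by
  simp [pnorm]

/-- `‖y‖∞ ≤ L` iff both coordinates have absolute value `≤ L`. [folklore] -/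
theorem pnorm_le_iff {y : Site 2} {L : ℕ} : pnorm y ≤ L ↔ (y 0).natAbs ≤ L ∧ (y 1).natAbs ≤ L := by
  simp [pnorm]

/-- Membership in the planar box `box 2 L = [-L, L]²` is `‖y‖∞ ≤ L`. [folklore] -/
theorem mem_box_iff_pnorm_le {y : Site 2} {L : ℕ} : y ∈ box 2 L ↔ pnorm y ≤ L := by
  rw [mem_box, pnorm_le_iff, Fin.forall_fin_two]
  constructor
  · rintro ⟨⟨h0, h0'⟩, ⟨h1, h1'⟩⟩
    constructor <;> omega
  · rintro ⟨h0, h1⟩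
    refine ⟨⟨?_, ?_⟩, ⟨?_, ?_⟩⟩ <;> omega

/-- Adding a unit vector changes each coordinate's absolute value by at most one. [folklore] -/
theorem natAbs_add_single_le (y : Site 2) (i j : Fin 2) :
    ((y + Pi.single i 1 : Site 2) j).natAbs ≤ (y j).natAbs + 1 ∧
      (y j).natAbs ≤ ((y + Pi.single i 1 : Site 2) j).natAbs + 1 := by
  rw [Pi.add_apply, Pi.single_apply]
  split_ifs <;> omega

/-- `‖y + eᵢ‖∞ ≤ ‖y‖∞ + 1` and `‖y‖∞ ≤ ‖y + eᵢ‖∞ + 1`. [folklore] -/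
theorem pnorm_add_single_le (y : Site 2) (i : Fin 2) :
    pnorm (y + Pi.single i 1) ≤ pnorm y + 1 ∧ pnorm y ≤ pnorm (y + Pi.single i 1) + 1 := by
  have h0 := natAbs_add_single_le y i 0
  have h1 := natAbs_add_single_le y i 1
  simp only [pnorm]
  omega

/-- Adjacent sites of `ℤ²` have sup-norms differing by at most one. [folklore] -/
theorem pnorm_le_succ_of_adj {y y' : Site 2} (h : (zdGraph 2).Adj y y') : pnorm y' ≤ pnorm y + 1 := by
  rw [zdGraph_adj_iff] at h
  obtain ⟨i, h | h⟩ := h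
  · subst h
    exact (pnorm_add_single_le y i).1
  · subst h
    exact (pnorm_add_single_le y' i).2

/-- Symmetric form: `‖y‖∞ ≤ ‖y'‖∞ + 1` for adjacent `y, y'`. [folklore] -/
theorem pnorm_le_succ_of_adj' {y y' : Site 2} (h : (zdGraph 2).Adj y y') : pnorm y ≤ pnorm y' + 1 :=
  pnorm_le_succ_of_adj h.symm

/-! ### Adjacency in `ℋ_n` -/

/-- Adjacency in `ℋ_n`, sorted into "horizontal" (same residue, adjacent columns) and "vertical"
(same column, residues differing by one). [folklore] -/
theorem adj_cases {a b : Vert n} (h : (slabTorusGraph n).Adj a b) :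
    (a.1 = b.1 ∧ (zdGraph 2).Adj a.2 b.2) ∨ (a.2 = b.2 ∧ a.1 ≠ b.1 ∧ (b.1 = a.1 + 1 ∨ a.1 = b.1 + 1)) :=
  h

/-- The columns of adjacent vertices are equal or adjacent in `ℤ²`. [folklore] -/
theorem col_eq_or_adj_of_adj {a b : Vert n} (h : (slabTorusGraph n).Adj a b) :
    a.2 = b.2 ∨ (zdGraph 2).Adj a.2 b.2 := by
  rcases adj_cases h with ⟨-, h2⟩ | ⟨h1, -⟩
  · exact Or.inr h2
  · exact Or.inl h1

/-- Sup-norms of the columns of adjacent vertices differ by at most one. [folklore] -/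
theorem pnorm_le_succ_of_adj_vert {a b : Vert n} (h : (slabTorusGraph n).Adj a b) :
    pnorm b.2 ≤ pnorm a.2 + 1 := by
  rcases col_eq_or_adj_of_adj h with h | h
  · rw [h]; exact Nat.le_succ _
  · exact pnorm_le_succ_of_adj h

/-- A horizontal step: `(t, y) ∼ (t, y')` for `y ∼ y'` in `ℤ²`. [folklore] -/
theorem adj_horizontal (t : ZMod n) {y y' : Site 2} (h : (zdGraph 2).Adj y y') :
    (slabTorusGraph n).Adj (t, y) (t, y') :=
  Or.inl ⟨rfl, h⟩

/-- A vertical step: `(t, y) ∼ (t + 1, y)` as soon as `1 ≠ 0` in `ℤ/n`, i.e. `n ≠ 1`.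
[folklore] -/
theorem adj_vertical (hn : n ≠ 1) (t : ZMod n) (y : Site 2) :
    (slabTorusGraph n).Adj (t, y) (t + 1, y) := by
  refine Or.inr ⟨rfl, ?_, Or.inl rfl⟩
  intro h
  have h1 : (1 : ZMod n) = 0 := by
    have := congrArg (fun s => s - t) h
    simpa using this.symm
  exact hn ((ZMod.one_eq_zero_iff).1 h1)

/-! ### Columns and the edges at a column -/

/-- The vertical (cycle) edges `{(t, c), (t+1, c)}` of the column `K_c = C_n × {c}`
(Martineau–Severo's ball `B_r(u)` becomes this column). [cite: MartineauSevero2019, §4] -/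
def cycE (n : ℕ) (c : Site 2) : Set (Sym2 (Vert n)) :=
  {e | ∃ t : ZMod n, e = s((t, c), (t + 1, c))}

/-- The edges of `ℋ_n` meeting the column `K_c`: those with an endpoint in column `c` (the
`n` vertical edges of `K_c` and the `4n` horizontal edges towards the neighbouring columns).
[folklore] -/
def colE (n : ℕ) (c : Site 2) : Set (Sym2 (Vert n)) :=
  {e | ∃ x ∈ e, x.2 = c}

/-- Cycle edges of `K_c` meet `K_c`. [folklore] -/
theorem cycE_subset_colE (c : Site 2) : cycE n c ⊆ colE n c := by
  rintro e ⟨t, rfl⟩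
  exact ⟨(t, c), Sym2.mem_mk_left _ _, rfl⟩

/-- An edge `s(a, b)` meets `K_c` iff `a` or `b` lies in column `c`. [folklore] -/
theorem mk_mem_colE_iff {a b : Vert n} {c : Site 2} : s(a, b) ∈ colE n c ↔ a.2 = c ∨ b.2 = c := by
  constructor
  · rintro ⟨x, hx, hxc⟩
    rcases Sym2.mem_iff.1 hx with rfl | rfl
    · exact Or.inl hxc
    · exact Or.inr hxc
  · rintro (h | h)
    · exact ⟨a, Sym2.mem_mk_left _ _, h⟩
    · exact ⟨b, Sym2.mem_mk_right _ _, h⟩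

/-- A cycle edge of column `c'` meets column `c` only if `c' = c`. [folklore] -/
theorem eq_of_cycE_of_colE {c c' : Site 2} {e : Sym2 (Vert n)} (he : e ∈ cycE n c') (he' : e ∈ colE n c) :
    c' = c := by
  obtain ⟨t, rfl⟩ := he
  rcases mk_mem_colE_iff.1 he' with h | h <;> exact h

/-- Both endpoints of an edge of `ℋ_n` meeting `K_c` lie in `K_c` or in a neighbouring column.
[folklore] -/
theorem col_near_of_adj_of_colE {a b : Vert n} {c : Site 2} (hab : (slabTorusGraph n).Adj a b)
    (he : s(a, b) ∈ colE n c) : (b.2 = c ∨ (zdGraph 2).Adj c b.2) ∧ (a.2 = c ∨ (zdGraph 2).Adj c a.2) := by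
  rcases mk_mem_colE_iff.1 he with h | h
  · subst h
    refine ⟨?_, Or.inl rfl⟩
    rcases col_eq_or_adj_of_adj hab with h' | h'
    · exact Or.inl h'.symm
    · exact Or.inr h'
  · subst h
    refine ⟨Or.inl rfl, ?_⟩
    rcases col_eq_or_adj_of_adj hab with h' | h'
    · exact Or.inl h'
    · exact Or.inr h'.symm

/-! ### The enhanced cluster -/

/-- **The column-enhanced cluster of the origin in the box of radius `L + 1`**
(Martineau–Severo 2019, §4, the set `𝒞_o(ω, α) = ⋃ C_n`, column version, restricted to the
finite volume of §6): `InCl L ω α v` says that `v` is reached from `o` using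
* open edges `s(a, b) ∈ ω` of `ℋ_n` one of whose endpoint columns has sup-norm `≤ L`
  (`C_{2n+1}`: `ω`-clusters), and
* column bonuses: from a reached vertex `a` whose column `y = a.2` is marked (`y ∈ α`), has
  sup-norm `≤ L` and has all its `n` vertical edges open, every vertex of the four neighbouring
  columns is reached (`C_{2n+2}`).
[cite: MartineauSevero2019, §4 (definition of 𝒞_o(ω, α)), §6 (𝓔_L)] -/
inductive InCl (L : ℕ) (ω : Set (Sym2 (Vert n))) (α : Set (Site 2)) : Vert n → Prop
  | origin : InCl L ω α (origin n)
  | edge {a b : Vert n} : InCl L ω α a → (slabTorusGraph n).Adj a b → s(a, b) ∈ ω →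
      (pnorm a.2 ≤ L ∨ pnorm b.2 ≤ L) → InCl L ω α b
  | bonus {a b : Vert n} : InCl L ω α a → a.2 ∈ α → pnorm a.2 ≤ L →
      (∀ t : ZMod n, s((t, a.2), (t + 1, a.2)) ∈ ω) → (zdGraph 2).Adj a.2 b.2 → InCl L ω α b

/-- **The finite-volume event `𝓔_L`** (Martineau–Severo 2019, §6: `𝓔_L = {𝒞_o(ω, α) ∩ S_L ≠ ∅}`,
here with the sphere of columns of sup-norm `L + 1`): the enhanced cluster reaches a column of
sup-norm `L + 1`. [cite: MartineauSevero2019, §6 (𝓔_L)] -/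
def Reaches (L : ℕ) (ω : Set (Sym2 (Vert n))) (α : Set (Site 2)) : Prop :=
  ∃ v : Vert n, InCl L ω α v ∧ pnorm v.2 = L + 1

/-- The enhanced cluster is monotone in the configuration and in the marks (`𝓔_L` "is increasing
in both `ω` and `α`", Martineau–Severo 2019, §6). [cite: MartineauSevero2019, §6] -/
theorem InCl.mono {L : ℕ} {ω ω' : Set (Sym2 (Vert n))} {α α' : Set (Site 2)} (hω : ω ⊆ ω') (hα : α ⊆ α')
    {v : Vert n} (h : InCl L ω α v) : InCl L ω' α' v := by
  induction h with
  | origin => exact InCl.origin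
  | edge _ hab he hL ih => exact InCl.edge ih hab (hω he) hL
  | bonus _ hα' hL hcyc hadj ih => exact InCl.bonus ih (hα hα') hL (fun t => hω (hcyc t)) hadj

/-- `𝓔_L` is increasing in `(ω, α)`. [cite: MartineauSevero2019, §6] -/
theorem Reaches.mono {L : ℕ} {ω ω' : Set (Sym2 (Vert n))} {α α' : Set (Site 2)} (hω : ω ⊆ ω') (hα : α ⊆ α')
    (h : Reaches L ω α) : Reaches L ω' α' := by
  obtain ⟨v, hv, hL⟩ := h
  exact ⟨v, hv.mono hω hα, hL⟩

/-- Every vertex of the enhanced cluster has a column of sup-norm `≤ L + 1` (the cluster lives in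
the ball `B_{L+1}`). [cite: MartineauSevero2019, §6] -/
theorem InCl.pnorm_le {L : ℕ} {ω : Set (Sym2 (Vert n))} {α : Set (Site 2)} {v : Vert n} (h : InCl L ω α v) :
    pnorm v.2 ≤ L + 1 := by
  induction h with
  | origin => simp [SlabTorus.origin]
  | edge _ hab _ hL ih =>
    rcases hL with hL | hL
    · exact (pnorm_le_succ_of_adj_vert hab).trans (by omega)
    · omega
  | bonus _ _ hL _ hadj _ => exact (pnorm_le_succ_of_adj hadj).trans (by omega)

/-- The edges that the enhanced cluster in the box of radius `L + 1` may use: edges of `ℋ_n` with an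
endpoint column of sup-norm `≤ L`. [cite: MartineauSevero2019, §6] -/
def EL (n L : ℕ) : Set (Sym2 (Vert n)) :=
  {e | e ∈ (slabTorusGraph n).edgeSet ∧ ∃ x ∈ e, pnorm x.2 ≤ L}

/-- `s(a, b) ∈ E_L` iff `a ∼ b` and one endpoint column has sup-norm `≤ L`. [folklore] -/
theorem mk_mem_EL_iff {L : ℕ} {a b : Vert n} :
    s(a, b) ∈ EL n L ↔ (slabTorusGraph n).Adj a b ∧ (pnorm a.2 ≤ L ∨ pnorm b.2 ≤ L) := by
  simp only [EL, Set.mem_setOf_eq, SimpleGraph.mem_edgeSet, Sym2.mem_iff]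
  constructor
  · rintro ⟨hab, x, rfl | rfl, hx⟩
    · exact ⟨hab, Or.inl hx⟩
    · exact ⟨hab, Or.inr hx⟩
  · rintro ⟨hab, h | h⟩
    · exact ⟨hab, a, Or.inl rfl, h⟩
    · exact ⟨hab, b, Or.inr rfl, h⟩

/-- The vertical edges of a column of sup-norm `≤ L` belong to `E_L` (for `n ≠ 1`). [folklore] -/
theorem cycE_subset_EL (hn : n ≠ 1) {L : ℕ} {c : Site 2} (hc : pnorm c ≤ L) : cycE n c ⊆ EL n L := by
  rintro e ⟨t, rfl⟩
  exact mk_mem_EL_iff.2 ⟨adj_vertical hn t c, Or.inl hc⟩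

/-- Edges meeting a column of sup-norm `≤ L` belong to `E_L`. [folklore] -/
theorem colE_inter_edgeSet_subset_EL {L : ℕ} {c : Site 2} (hc : pnorm c ≤ L) :
    colE n c ∩ (slabTorusGraph n).edgeSet ⊆ EL n L := by
  rintro e ⟨⟨x, hx, hxc⟩, he⟩
  exact ⟨he, x, hx, hxc ▸ hc⟩

/-- **Locality.** The enhanced cluster only depends on the open edges in `E_L` and on the marks of
columns of sup-norm `≤ L` ("the event `𝓔_L` … depends only on finitely many coordinates",
Martineau–Severo 2019, §6). [cite: MartineauSevero2019, §6] -/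
theorem InCl.congr (hn : n ≠ 1) {L : ℕ} {ω ω' : Set (Sym2 (Vert n))} {α α' : Set (Site 2)}
    (hω : ∀ e ∈ EL n L, e ∈ ω → e ∈ ω') (hα : ∀ y, pnorm y ≤ L → y ∈ α → y ∈ α')
    {v : Vert n} (h : InCl L ω α v) : InCl L ω' α' v := by
  induction h with
  | origin => exact InCl.origin
  | edge _ hab he hL ih => exact InCl.edge ih hab (hω _ (mk_mem_EL_iff.2 ⟨hab, hL⟩) he) hL
  | @bonus a b _ hαa hL hcyc hadj ih =>
    exact InCl.bonus ih (hα _ hL hαa) hL (fun t => hω _ (cycE_subset_EL hn hL ⟨t, rfl⟩) (hcyc t)) hadj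

/-- Locality of `𝓔_L` (same statement for the event). [cite: MartineauSevero2019, §6] -/
theorem Reaches.congr (hn : n ≠ 1) {L : ℕ} {ω ω' : Set (Sym2 (Vert n))} {α α' : Set (Site 2)}
    (hω : ∀ e ∈ EL n L, e ∈ ω → e ∈ ω') (hα : ∀ y, pnorm y ≤ L → y ∈ α → y ∈ α')
    (h : Reaches L ω α) : Reaches L ω' α' := by
  obtain ⟨v, hv, hL⟩ := h
  exact ⟨v, hv.congr hn hω hα, hL⟩

/-! ### Open columns are swallowed whole -/

/-- Every residue is reached from `t₀` by adding `1` repeatedly (`n ≠ 0`). [folklore] -/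
theorem exists_eq_add_natCast [NeZero n] (t₀ t : ZMod n) : ∃ k : ℕ, t = t₀ + k :=
  ⟨(t - t₀).val, by rw [ZMod.natCast_zmod_val]; ring⟩

/-- If a vertex `a` of the enhanced cluster has all vertical edges of its column open and its
column has sup-norm `≤ L`, the whole column `K_{a.2}` belongs to the cluster (the column is an
open cycle through `a`). [folklore] -/
theorem InCl.column [NeZero n] (hn : n ≠ 1) {L : ℕ} {ω : Set (Sym2 (Vert n))} {α : Set (Site 2)}
    {a : Vert n} (ha : InCl L ω α a) (hL : pnorm a.2 ≤ L)
    (hcyc : ∀ t : ZMod n, s((t, a.2), (t + 1, a.2)) ∈ ω) (t : ZMod n) : InCl L ω α (t, a.2) := by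
  obtain ⟨k, rfl⟩ := exists_eq_add_natCast a.1 t
  induction k with
  | zero =>
    have : (a.1 + ((0 : ℕ) : ZMod n), a.2) = a := by ext <;> simp
    rw [this]
    exact ha
  | succ k ih =>
    have hstep : InCl L ω α (a.1 + k + 1, a.2) :=
      InCl.edge ih (adj_vertical hn _ _) (hcyc _) (Or.inl hL)
    have : (a.1 + ((k + 1 : ℕ) : ZMod n), a.2) = (a.1 + k + 1, a.2) := by
      ext <;> simp [Nat.cast_succ, add_assoc]
    rw [this]
    exact hstep

/-- After a column bonus at `a`, every vertex of a neighbouring column is in the cluster; in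
particular so is every vertex `b` with `b.2` adjacent to `a.2` — restated for convenience with the
residue of `b` free. [cite: MartineauSevero2019, §4] -/
theorem InCl.bonus' {L : ℕ} {ω : Set (Sym2 (Vert n))} {α : Set (Site 2)} {a : Vert n}
    (ha : InCl L ω α a) (hα : a.2 ∈ α) (hL : pnorm a.2 ≤ L)
    (hcyc : ∀ t : ZMod n, s((t, a.2), (t + 1, a.2)) ∈ ω) (t : ZMod n) {y : Site 2}
    (hy : (zdGraph 2).Adj a.2 y) : InCl L ω α (t, y) :=
  InCl.bonus (b := (t, y)) ha hα hL hcyc hy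

end SlabTorus

end Literature.Probability.Percolation
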